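import Literature.NumberTheory.Transcendental.CurvePeriodsEllipticEndgameProofs
import Literature.NumberTheory.Transcendental.CurvePeriodsPathCalculusProofs
import Literature.NumberTheory.Transcendental.SigmaJets
import HarnessLib

/-!
# Periods of curve type on an elliptic curve, VIII: the symbol of a lifted path depends only on the end points of its lift

Companion of `Literature/NumberTheory/Transcendental/CurvePeriods.lean` (Huber–Wüstholz 2022,
Thm. 13.3 (2), rendered on explicit period symbols `(Z, ω, γ)` with the elementary relations
(R1)–(R5)) and of the genus-one files `CurvePeriodsElliptic*Proofs.lean` (`E_L : y² = x³ − (g₂/4)x − g₃/4`,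
uniformised by `φ = (℘, ℘′/2)`). A structural consequence of the closed-path normal form
(`CurvePeriodsEllipticGridProofs.lean`, `CurvePeriodsEllipticEndgameProofs.lean`), used for OPEN
paths: **modulo the elementary relations, the symbol `(E_L, ω, φ∘g)` of a lifted path depends
only on the two end points `g(0), g(1) ∈ ℂ ∖ Λ` of the lift** — the relations of
`H₁(E_L^an, D; ℤ)` hold in the symbol calculus, without any homotopy in `ℂ ∖ Λ`.

* `Ell.period_theta0_liftPath`, `Ell.period_theta1_liftPath` — `∫_{φ∘g} θ₀ = 2(g 1 − g 0)`,
  `∫_{φ∘g} θ₁ = −2(ζ(g 1) − ζ(g 0))` for every `C¹` lift `g` (book §18.1);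
* `Ell.exists_rel_symbol_uniform` — the de Rham reduction `ω = aθ₀ + bθ₁ + dP + ν`
  (`Weier.exists_reduction`) as a relation with the SAME `a, b, P` for every path;
* `Ell.exists_loop_normalForm_rat` — the closed-path normal form with RATIONAL loop coefficients:
  `(E_L, θ₀, γ) ∼ Σ_j q_j (E_L, θ₀, φ∘[g₀, g₀+ω_j])`,
  `(E_L, θ₁, γ) ∼ Σ_j q_j (E_L, θ₁, φ∘[g₀, g₀+ω_j]) + e · 𝟙`, `q ∈ ℚ²`, `e ∈ ℚ̄`
  (`Ell.exists_stepComb_of_closed` + `Ell.span_stepSym_theta0/1`);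
* `Ell.span_theta_of_closed_of_period_eq_zero` — a closed path with vanishing `θ₀`-period has
  `θ₀`-symbol `∼ 0` and `θ₁`-symbol `∼ e · 𝟙` (`Σ q_j ω_j = 0` forces `q = 0` by the
  `ℝ`-independence of `ω₁, ω₂`);
* `Ell.span_liftPath_sub_liftPath_theta`, `Ell.span_liftPath_sub_liftPath` — **lift invariance**:
  for `C¹` lifts `g, g′` with `g(0) = g′(0)`, `g(1) = g′(1)` (algebraic end points) and every form
  `ω` over `ℚ̄`, `(E_L, ω, φ∘g) ∼ (E_L, ω, φ∘g′)`: the loop `(φ∘g) ⋆ (φ∘g′)⁻`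
  (`CurvePath.concat`, `span_concat`, `span_single_add_single_reverse`) is closed with both
  periods zero, hence `∼ 0`.

## References

* A. Huber, G. Wüstholz, *Transcendence and Linear Relations of 1-Periods*, Cambridge Tracts in
  Mathematics 227, CUP 2022 [HuberWustholz2022]: §3.3.1 (pp. 42–44: `H₁(C, D; ℤ)` by smooth
  paths; homotopic paths), §13.2 (p. 123), §18.1 (p. 160), Thm. 13.3 (2) (p. 121).
-/

noncomputable section

open scoped BigOperators
open scoped PeriodPair
open scoped Topology
open MvPolynomial Set Complex Filter

namespace Literature.NumberTheory.Transcendental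

namespace CurvePeriods

set_option quotPrecheck false in
/-- Membership in the `ℚ̄`-span of the elementary relations, in the format of the conclusion of
`HuberWustholzCurvePeriods`. -/
local notation "InSpan" c:max => ∃ (k : ℕ) (ρ : Fin k → (PeriodSymbol →₀ ℂ)) (a : Fin k → ℂ),
  (∀ l, IsElementaryRelation (ρ l)) ∧ (∀ l, IsAlgebraic ℚ (a l)) ∧ c = ∑ l, a l • ρ l

/-- Evaluation is subtractive. [folklore] -/
private theorem evalCombination_sub' (c c' : PeriodSymbol →₀ ℂ) :
    evalCombination (c - c') = evalCombination c - evalCombination c' := by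
  rw [sub_eq_add_neg, evalCombination_add, ← neg_one_smul ℂ c', evalCombination_smul]
  ring

namespace Ell

variable (L : PeriodPair)

/-! ### Periods of lifted paths -/

/-- The derivative of `t ↦ φ(g(t))` for a `C¹` lift `g`. [folklore] -/
theorem hasDerivAt_phi_comp {g : ℝ → ℂ} (hg : ContDiff ℝ 1 g) {t : ℝ} (ht : g t ∉ L.lattice)
    (k : Fin 2) : HasDerivAt (fun s => phi L (g s) k) (deriv g t * phiD L (g t) k) t := by
  have hgd : HasDerivAt g (deriv g t) t := (hg.differentiable one_ne_zero t).hasDerivAt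
  have h := (hasDerivAt_phi L ht k).scomp t hgd
  simpa [Function.comp_def] using h

section Periods

variable (h₂ : IsAlgebraic ℚ L.g₂) (h₃ : IsAlgebraic ℚ L.g₃)
include h₂ h₃

/-- **`∫_{φ∘g} θ₀ = 2(g(1) − g(0))`** for every `C¹` lift `g` (the elliptic integral of the
first kind is the lift: `φ^*θ₀ = 2dz`). [cite: HuberWustholz2022, §18.1 (p. 160)] -/
theorem period_theta0_liftPath (g : ℝ → ℂ) (hg : ContDiff ℝ 1 g)
    (hΛ : ∀ t ∈ Icc (0 : ℝ) 1, g t ∉ L.lattice) (h0 : IsAlgPt L (g 0)) (h1 : IsAlgPt L (g 1)) :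
    (⟨curve L, smooth L h₂ h₃, theta0 L, hasAlgCoeffs_theta0 L h₂ h₃, liftPath L g hg hΛ h0 h1⟩ :
      PeriodSymbol).period = 2 * (g 1 - g 0) := by
  rw [PeriodSymbol.period_eq_of_hasDerivAt
    ⟨curve L, smooth L h₂ h₃, theta0 L, hasAlgCoeffs_theta0 L h₂ h₃, liftPath L g hg hΛ h0 h1⟩
    (fun t => phi L (g t)) (fun t k => deriv g t * phiD L (g t) k) (fun t _ => rfl)
    (fun t ht k => hasDerivAt_phi_comp L hg (hΛ t (Ioo_subset_Icc_self ht)) k)]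
  have hF : ∀ t ∈ Icc (0 : ℝ) 1, (∑ k : Fin 2, eval (phi L (g t)) (theta0 L k) *
      (deriv g t * phiD L (g t) k)) = 2 * deriv g t := fun t ht => by
    have h := theta0_phi L (hΛ t ht)
    rw [Fin.sum_univ_two] at h ⊢
    linear_combination deriv g t * h
  have hderiv : ∀ t ∈ uIcc (0 : ℝ) 1, HasDerivAt (fun s : ℝ => 2 * g s) (2 * deriv g t) t :=
    fun t _ => ((hg.differentiable one_ne_zero t).hasDerivAt).const_mul 2
  have hcont : Continuous fun t : ℝ => 2 * deriv g t :=
    continuous_const.mul (hg.continuous_deriv le_rfl)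
  rw [intervalIntegral.integral_congr (g := fun t => 2 * deriv g t)
    (fun t ht => hF t (by rwa [uIcc_of_le zero_le_one] at ht)),
    intervalIntegral.integral_eq_sub_of_hasDerivAt hderiv (hcont.intervalIntegrable _ _)]
  ring

/-- **`∫_{φ∘g} θ₁ = −2(ζ(g(1)) − ζ(g(0)))`** for every `C¹` lift `g` (`φ^*θ₁ = 2℘ dz = −2dζ`).
[cite: HuberWustholz2022, §18.1 (p. 160)] -/
theorem period_theta1_liftPath (g : ℝ → ℂ) (hg : ContDiff ℝ 1 g)
    (hΛ : ∀ t ∈ Icc (0 : ℝ) 1, g t ∉ L.lattice) (h0 : IsAlgPt L (g 0)) (h1 : IsAlgPt L (g 1)) :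
    (⟨curve L, smooth L h₂ h₃, theta1 L, hasAlgCoeffs_theta1 L h₂ h₃, liftPath L g hg hΛ h0 h1⟩ :
      PeriodSymbol).period = -2 * (L.weierstrassZeta (g 1) - L.weierstrassZeta (g 0)) := by
  rw [PeriodSymbol.period_eq_of_hasDerivAt
    ⟨curve L, smooth L h₂ h₃, theta1 L, hasAlgCoeffs_theta1 L h₂ h₃, liftPath L g hg hΛ h0 h1⟩
    (fun t => phi L (g t)) (fun t k => deriv g t * phiD L (g t) k) (fun t _ => rfl)
    (fun t ht k => hasDerivAt_phi_comp L hg (hΛ t (Ioo_subset_Icc_self ht)) k)]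
  have hF : ∀ t ∈ Icc (0 : ℝ) 1, (∑ k : Fin 2, eval (phi L (g t)) (theta1 L k) *
      (deriv g t * phiD L (g t) k)) = 2 * ℘[L] (g t) * deriv g t := fun t ht => by
    have h := theta1_phi L (hΛ t ht)
    rw [Fin.sum_univ_two] at h ⊢
    linear_combination deriv g t * h
  have hderiv : ∀ t ∈ uIcc (0 : ℝ) 1, HasDerivAt (fun s : ℝ => -2 * L.weierstrassZeta (g s))
      (2 * ℘[L] (g t) * deriv g t) t := fun t ht => by
    rw [uIcc_of_le zero_le_one] at ht
    have hgd : HasDerivAt g (deriv g t) t := (hg.differentiable one_ne_zero t).hasDerivAt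
    have h := ((PeriodPair.hasDerivAt_weierstrassZeta (L := L) (hΛ t ht)).scomp t hgd).const_mul (-2)
    refine h.congr_deriv ?_
    simp only [smul_eq_mul]
    ring
  have hcont : ContinuousOn (fun t : ℝ => 2 * ℘[L] (g t) * deriv g t) (Icc 0 1) := by
    refine (continuousOn_const.mul ?_).mul (hg.continuous_deriv le_rfl).continuousOn
    have h := (liftPath L g hg hΛ h0 h1).contDiffOn.continuousOn
    have h0' := (continuous_apply (0 : Fin 2)).comp_continuousOn h
    simpa [Function.comp_def] using h0'
  have hint : IntervalIntegrable (fun t : ℝ => 2 * ℘[L] (g t) * deriv g t)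
      MeasureTheory.volume 0 1 :=
    (hcont.mono (by rw [uIcc_of_le zero_le_one])).intervalIntegrable
  rw [intervalIntegral.integral_congr (g := fun t => 2 * ℘[L] (g t) * deriv g t)
    (fun t ht => hF t (by rwa [uIcc_of_le zero_le_one] at ht)),
    intervalIntegral.integral_eq_sub_of_hasDerivAt hderiv hint]
  ring

end Periods

/-! ### The de Rham reduction with an explicit exact part -/

section Forms

variable (h₂ : IsAlgebraic ℚ L.g₂) (h₃ : IsAlgebraic ℚ L.g₃)
include h₂ h₃

/-- **Reduction of a form, uniformly in the path**: for every polynomial `1`-form `ω` over `ℚ̄`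
there are `a, b ∈ ℚ̄` and `P ∈ ℚ̄[x, y]` such that for EVERY path `γ` on `E_L`,
`(E_L, ω, γ) − a (E_L, θ₀, γ) − b (E_L, θ₁, γ) − (P(γ(1)) − P(γ(0))) · 𝟙` lies in the span
(`Weier.exists_reduction`: `ω = aθ₀ + bθ₁ + dP + ν`; (R1)–(R3)). [cite: HuberWustholz2022, §13.2 (p. 123)] -/
theorem exists_rel_symbol_uniform (ω : Fin 2 → MvPolynomial (Fin 2) ℂ) (hω : ∀ k, HasAlgCoeffs (ω k)) :
    ∃ (a b : ℂ) (P : MvPolynomial (Fin 2) ℂ), IsAlgebraic ℚ a ∧ IsAlgebraic ℚ b ∧ HasAlgCoeffs P ∧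
      ∀ γ : CurvePath (curve L),
        InSpan (Finsupp.single (⟨curve L, smooth L h₂ h₃, ω, hω, γ⟩ : PeriodSymbol) (1 : ℂ) -
          a • Finsupp.single (⟨curve L, smooth L h₂ h₃, theta0 L, hasAlgCoeffs_theta0 L h₂ h₃, γ⟩ :
            PeriodSymbol) (1 : ℂ) -
          b • Finsupp.single (⟨curve L, smooth L h₂ h₃, theta1 L, hasAlgCoeffs_theta1 L h₂ h₃, γ⟩ :
            PeriodSymbol) (1 : ℂ) -
          (eval (γ.toFun 1) P - eval (γ.toFun 0) P) • Finsupp.single PeriodSymbol.unit (1 : ℂ)) := by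
  have hE := smooth L h₂ h₃
  obtain ⟨a, b, P, ν, ha, hb, hP, hν, hv, he⟩ := Weier.exists_reduction (A L) (B L)
    (isAlgebraic_A L h₂) (isAlgebraic_B L h₃) (disc_ne_zero L) ω hω
  have hθ := hasAlgCoeffs_theta0 L h₂ h₃
  have hxθ := hasAlgCoeffs_theta1 L h₂ h₃
  have haθ : ∀ k, HasAlgCoeffs ((a • theta0 L) k) := fun k => (hθ k).smul ha
  have hbθ : ∀ k, HasAlgCoeffs ((b • theta1 L) k) := fun k => (hxθ k).smul hb
  have h₁ : ∀ k, HasAlgCoeffs ((a • theta0 L + b • theta1 L) k) := fun k => (haθ k).add (hbθ k)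
  have hdP : ∀ k, HasAlgCoeffs (formD P k) := hP.formD
  have h₂' : ∀ k, HasAlgCoeffs ((a • theta0 L + b • theta1 L + formD P) k) :=
    fun k => (h₁ k).add (hdP k)
  refine ⟨a, b, P, ha, hb, hP, fun γ => ?_⟩
  have r₁ := IsElementaryRelation.add _ hE γ ω _ ν hω h₂' hν he
  have r₂ := IsElementaryRelation.vanish _ hE γ ν hν hv
  have r₃ := IsElementaryRelation.add _ hE γ _ _ _ h₂' h₁ hdP rfl
  have r₄ := IsElementaryRelation.exact _ hE γ P hP _ hdP rfl
  have r₅ := IsElementaryRelation.add _ hE γ _ _ _ h₁ haθ hbθ rfl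
  have r₆ := IsElementaryRelation.smul _ hE γ a ha (theta0 L) _ hθ haθ rfl
  have r₇ := IsElementaryRelation.smul _ hE γ b hb (theta1 L) _ hxθ hbθ rfl
  obtain ⟨k, ρ, c, hρ, hc, hsum⟩ := span_add (span_add (span_add (span_add (span_add (span_add
    (span_of_rel r₁) (span_of_rel r₂)) (span_of_rel r₃)) (span_of_rel r₄)) (span_of_rel r₅))
    (span_of_rel r₆)) (span_of_rel r₇)
  refine ⟨k, ρ, c, hρ, hc, ?_⟩
  rw [← hsum]
  abel

end Forms

/-! ### Closed paths: the normal form with RATIONAL loop coefficients -/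

section Rational

variable (h₂ : IsAlgebraic ℚ L.g₂) (h₃ : IsAlgebraic ℚ L.g₃)
include h₂ h₃

/-- **Normal form of a closed path for `θ₀` and `θ₁`, with rational loop coefficients**: for a
closed `C¹` path `γ` on `E_L` there are `q ∈ ℚ²` and `e ∈ ℚ̄` with
`(E_L, θ₀, γ) ∼ Σ_j q_j (E_L, θ₀, φ∘[g₀, g₀+ω_j])` and
`(E_L, θ₁, γ) ∼ Σ_j q_j (E_L, θ₁, φ∘[g₀, g₀+ω_j]) + e · 𝟙` — the same `q` for both forms
(`q_j = 4⁻ᵏ ×` the signed number of unit steps of direction `j` in the step combination of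
`Ell.exists_stepComb_of_closed`, descended by `Ell.span_stepSym_theta0/1`).
[cite: HuberWustholz2022, §3.3.1 (pp. 42–44), §18.1 (p. 160)] -/
theorem exists_loop_normalForm_rat (γ : CurvePath (curve L)) (hcl : γ.toFun 1 = γ.toFun 0) :
    ∃ (q : Fin 2 → ℚ) (e : ℂ), IsAlgebraic ℚ e ∧
      InSpan (Finsupp.single (⟨curve L, smooth L h₂ h₃, theta0 L, hasAlgCoeffs_theta0 L h₂ h₃, γ⟩ :
          PeriodSymbol) (1 : ℂ) -
        ∑ j, ((q j : ℚ) : ℂ) • Finsupp.single (stepSym L h₂ h₃ (theta0 L)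
          (hasAlgCoeffs_theta0 L h₂ h₃) 0 ((0, 0), j)) (1 : ℂ)) ∧
      InSpan (Finsupp.single (⟨curve L, smooth L h₂ h₃, theta1 L, hasAlgCoeffs_theta1 L h₂ h₃, γ⟩ :
          PeriodSymbol) (1 : ℂ) -
        ∑ j, ((q j : ℚ) : ℂ) • Finsupp.single (stepSym L h₂ h₃ (theta1 L)
          (hasAlgCoeffs_theta1 L h₂ h₃) 0 ((0, 0), j)) (1 : ℂ) -
        e • Finsupp.single PeriodSymbol.unit (1 : ℂ)) := by
  classical
  obtain ⟨k, c, hkc⟩ := exists_stepComb_of_closed L h₂ h₃ γ hcl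
  choose C hC hrel1 using fun x : (ℤ × ℤ) × Fin 2 => span_stepSym_theta1 L h₂ h₃ k x.1 x.2
  have hrel0 := fun x : (ℤ × ℤ) × Fin 2 => span_stepSym_theta0 L h₂ h₃ k x.1 x.2
  set w : (ℤ × ℤ) × Fin 2 → ℂ := fun x => (c x : ℂ) * ((2 : ℂ) ^ (2 * k))⁻¹ with hw
  have hcalg : ∀ x, IsAlgebraic ℚ ((c x : ℤ) : ℂ) := fun x => isAlgebraic_int (c x)
  set q : Fin 2 → ℚ := fun j => ∑ x ∈ c.support, if x.2 = j then (c x : ℚ) / 2 ^ (2 * k) else 0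
    with hq
  have hqA : ∀ j, ((q j : ℚ) : ℂ) = ∑ x ∈ c.support, if x.2 = j then w x else 0 := fun j => by
    rw [hq, Rat.cast_sum]
    refine Finset.sum_congr rfl fun x _ => ?_
    split_ifs
    · rw [hw, Rat.cast_div, Rat.cast_intCast, Rat.cast_pow, Rat.cast_ofNat, div_eq_mul_inv]
    · exact Rat.cast_zero
  have hg0 := hkc (theta0 L) (hasAlgCoeffs_theta0 L h₂ h₃)
  have hg1 := hkc (theta1 L) (hasAlgCoeffs_theta1 L h₂ h₃)
  refine ⟨q, ∑ x ∈ c.support, (c x : ℂ) * C x,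
    isAlgebraic_finsetSum _ _ fun x _ => (hcalg x).mul (hC x), ?_, ?_⟩
  · have hsum : InSpan (∑ x ∈ c.support, (c x : ℂ) •
        (Finsupp.single (stepSym L h₂ h₃ (theta0 L) (hasAlgCoeffs_theta0 L h₂ h₃) (2 * k) (x.1, x.2))
            (1 : ℂ) -
          ((2 : ℂ) ^ (2 * k))⁻¹ • Finsupp.single (stepSym L h₂ h₃ (theta0 L)
            (hasAlgCoeffs_theta0 L h₂ h₃) 0 ((0, 0), x.2)) 1)) :=
      span_finsetSum _ _ fun x _ => span_smul (hcalg x) (hrel0 x)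
    simp_rw [hqA]
    rw [← sum_smul_single_dir]
    obtain ⟨K, ρ, cf, hρ, hcf, he⟩ := span_add hg0 hsum
    refine ⟨K, ρ, cf, hρ, hcf, ?_⟩
    rw [← he]
    simp only [stepComb, Finsupp.sum, hw, smul_sub, smul_smul, Finset.sum_sub_distrib, Prod.mk.eta]
    abel
  · have hsum : InSpan (∑ x ∈ c.support, (c x : ℂ) •
        (Finsupp.single (stepSym L h₂ h₃ (theta1 L) (hasAlgCoeffs_theta1 L h₂ h₃) (2 * k) (x.1, x.2))
            (1 : ℂ) -
          ((2 : ℂ) ^ (2 * k))⁻¹ • Finsupp.single (stepSym L h₂ h₃ (theta1 L)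
            (hasAlgCoeffs_theta1 L h₂ h₃) 0 ((0, 0), x.2)) 1 -
          C x • Finsupp.single PeriodSymbol.unit (1 : ℂ))) :=
      span_finsetSum _ _ fun x _ => span_smul (hcalg x) (hrel1 x)
    simp_rw [hqA]
    rw [← sum_smul_single_dir]
    obtain ⟨K, ρ, cf, hρ, hcf, he⟩ := span_add hg1 hsum
    refine ⟨K, ρ, cf, hρ, hcf, ?_⟩
    rw [← he]
    simp only [stepComb, Finsupp.sum, hw, smul_sub, smul_smul, Finset.sum_sub_distrib, Prod.mk.eta,
      Finset.sum_smul]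
    abel

omit h₂ h₃ in
/-- A rational combination `q₀ ω₁ + q₁ ω₂ = 0` of the periods is trivial (`ω₁, ω₂` are
`ℝ`-independent). [folklore] -/
theorem rat_eq_zero_of_combination (q : Fin 2 → ℚ)
    (h : ((q 0 : ℚ) : ℂ) * L.ω₁ + ((q 1 : ℚ) : ℂ) * L.ω₂ = 0) : q = 0 := by
  have hli := LinearIndependent.pair_iff.mp L.indep (q 0 : ℝ) (q 1 : ℝ) (by
    simp only [Complex.real_smul, Complex.ofReal_ratCast]
    exact h)
  funext j
  fin_cases j
  · exact_mod_cast hli.1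
  · exact_mod_cast hli.2

/-- **A closed path whose `θ₀`-period vanishes has `θ₀`-symbol `∼ 0` and `θ₁`-symbol `∼ e · 𝟙`.**
(Its rational loop coefficients vanish: `Σ q_j ω_j = 0` forces `q = 0`.) [folklore] -/
theorem span_theta_of_closed_of_period_eq_zero (γ : CurvePath (curve L))
    (hcl : γ.toFun 1 = γ.toFun 0)
    (hper : (⟨curve L, smooth L h₂ h₃, theta0 L, hasAlgCoeffs_theta0 L h₂ h₃, γ⟩ :
      PeriodSymbol).period = 0) :
    InSpan (Finsupp.single (⟨curve L, smooth L h₂ h₃, theta0 L, hasAlgCoeffs_theta0 L h₂ h₃, γ⟩ :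
        PeriodSymbol) (1 : ℂ)) ∧
    ∃ e : ℂ, IsAlgebraic ℚ e ∧
      InSpan (Finsupp.single (⟨curve L, smooth L h₂ h₃, theta1 L, hasAlgCoeffs_theta1 L h₂ h₃, γ⟩ :
          PeriodSymbol) (1 : ℂ) - e • Finsupp.single PeriodSymbol.unit (1 : ℂ)) := by
  obtain ⟨q, e, he, h0, h1⟩ := exists_loop_normalForm_rat L h₂ h₃ γ hcl
  -- the `θ₀`-period: `0 = 2 (q₀ ω₁ + q₁ ω₂)`
  have hq : q = 0 := by
    obtain ⟨K, ρ, cf, hρ, -, hsum⟩ := h0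
    have hev := evalCombination_eq_zero_of_isElementaryRelation ρ cf hρ
    rw [← hsum, evalCombination_sub', evalCombination_single, hper, evalCombination_finsetSum,
      Fin.sum_univ_two, evalCombination_smul, evalCombination_smul, evalCombination_single,
      evalCombination_single, period_stepSym_theta0_zero, period_stepSym_theta0_zero] at hev
    refine rat_eq_zero_of_combination L q ?_
    simp only [Matrix.cons_val_zero, Matrix.cons_val_one] at hev
    linear_combination -hev / 2
  subst hq
  simp only [Pi.zero_apply, Rat.cast_zero, zero_smul, Finset.sum_const_zero, sub_zero] at h0 h1
  exact ⟨h0, e, he, h1⟩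

end Rational

/-! ### Lift invariance -/

section LiftInvariance

variable (h₂ : IsAlgebraic ℚ L.g₂) (h₃ : IsAlgebraic ℚ L.g₃)
include h₂ h₃

/-- **Two lifts with the same end points have the same `θ₀`- and `θ₁`-symbols.** If
`g, g′ : [0,1] → ℂ ∖ Λ` are `C¹` with `g(0) = g′(0)`, `g(1) = g′(1)` (algebraic end points), then
`(E_L, θᵢ, φ∘g) − (E_L, θᵢ, φ∘g′)` lies in the `ℚ̄`-span of the elementary relations for
`i = 0, 1`: the loop `(φ∘g) ⋆ (φ∘g′)⁻` is closed with vanishing periods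
`2(g(1) − g(0)) − 2(g′(1) − g′(0)) = 0`, `−2(ζ(g 1) − ζ(g 0)) + 2(ζ(g′ 1) − ζ(g′ 0)) = 0`, hence
`∼ 0` by the rational normal form. NO homotopy between `g` and `g′` in `ℂ ∖ Λ` is required.
[cite: HuberWustholz2022, §3.3.1 (pp. 42–44), §18.1 (p. 160)] -/
theorem span_liftPath_sub_liftPath_theta {g g' : ℝ → ℂ} (hg : ContDiff ℝ 1 g)
    (hg' : ContDiff ℝ 1 g')
    (hΛ : ∀ t ∈ Icc (0 : ℝ) 1, g t ∉ L.lattice) (hΛ' : ∀ t ∈ Icc (0 : ℝ) 1, g' t ∉ L.lattice)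
    (h0 : IsAlgPt L (g 0)) (h1 : IsAlgPt L (g 1)) (h0' : IsAlgPt L (g' 0)) (h1' : IsAlgPt L (g' 1))
    (hs : g' 0 = g 0) (he : g' 1 = g 1) :
    InSpan (Finsupp.single (⟨curve L, smooth L h₂ h₃, theta0 L, hasAlgCoeffs_theta0 L h₂ h₃,
        liftPath L g hg hΛ h0 h1⟩ : PeriodSymbol) (1 : ℂ) -
      Finsupp.single (⟨curve L, smooth L h₂ h₃, theta0 L, hasAlgCoeffs_theta0 L h₂ h₃,
        liftPath L g' hg' hΛ' h0' h1'⟩ : PeriodSymbol) 1) ∧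
    InSpan (Finsupp.single (⟨curve L, smooth L h₂ h₃, theta1 L, hasAlgCoeffs_theta1 L h₂ h₃,
        liftPath L g hg hΛ h0 h1⟩ : PeriodSymbol) (1 : ℂ) -
      Finsupp.single (⟨curve L, smooth L h₂ h₃, theta1 L, hasAlgCoeffs_theta1 L h₂ h₃,
        liftPath L g' hg' hΛ' h0' h1'⟩ : PeriodSymbol) 1) := by
  have hE := smooth L h₂ h₃
  set γ := liftPath L g hg hΛ h0 h1 with hγ
  set γ' := liftPath L g' hg' hΛ' h0' h1' with hγ'
  have hj : γ.toFun 1 = γ'.reverse.toFun 0 := by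
    show phi L (g 1) = phi L (g' (1 - 0))
    rw [sub_zero, he]
  set δ := γ.concat γ'.reverse hj with hδ
  have hcl : δ.toFun 1 = δ.toFun 0 := by
    rw [hδ, CurvePath.concat_one, CurvePath.concat_zero]
    show phi L (g' (1 - 1)) = phi L (g 0)
    rw [sub_self, hs]
  -- `δ ∼ γ − γ′` for every form
  have hdiff : ∀ (ω : Fin 2 → MvPolynomial (Fin 2) ℂ) (hω : ∀ k, HasAlgCoeffs (ω k)),
      InSpan (Finsupp.single (⟨curve L, hE, ω, hω, δ⟩ : PeriodSymbol) (1 : ℂ) -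
        (Finsupp.single (⟨curve L, hE, ω, hω, γ⟩ : PeriodSymbol) 1 -
          Finsupp.single (⟨curve L, hE, ω, hω, γ'⟩ : PeriodSymbol) 1)) := fun ω hω => by
    obtain ⟨K, ρ, cf, hρ, hcf, hsum⟩ :=
      span_add (span_concat hE ω hω γ γ'.reverse hj) (span_single_add_single_reverse hE ω hω γ')
    exact ⟨K, ρ, cf, hρ, hcf, by rw [← hsum]; abel⟩
  -- periods of `δ`
  have hper : ∀ (ω : Fin 2 → MvPolynomial (Fin 2) ℂ) (hω : ∀ k, HasAlgCoeffs (ω k)),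
      (⟨curve L, hE, ω, hω, δ⟩ : PeriodSymbol).period =
        (⟨curve L, hE, ω, hω, γ⟩ : PeriodSymbol).period -
          (⟨curve L, hE, ω, hω, γ'⟩ : PeriodSymbol).period := fun ω hω => by
    obtain ⟨K, ρ, cf, hρ, -, hsum⟩ := hdiff ω hω
    have hev := evalCombination_eq_zero_of_isElementaryRelation ρ cf hρ
    rw [← hsum, evalCombination_sub', evalCombination_sub', evalCombination_single,
      evalCombination_single, evalCombination_single] at hev
    linear_combination hev
  have hper0 : (⟨curve L, hE, theta0 L, hasAlgCoeffs_theta0 L h₂ h₃, δ⟩ : PeriodSymbol).period = 0 := by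
    rw [hper, hγ, hγ', period_theta0_liftPath L h₂ h₃, period_theta0_liftPath L h₂ h₃, hs, he, sub_self]
  have hper1 : (⟨curve L, hE, theta1 L, hasAlgCoeffs_theta1 L h₂ h₃, δ⟩ : PeriodSymbol).period = 0 := by
    rw [hper, hγ, hγ', period_theta1_liftPath L h₂ h₃, period_theta1_liftPath L h₂ h₃, hs, he, sub_self]
  obtain ⟨hδ0, e, -, hδ1⟩ := span_theta_of_closed_of_period_eq_zero L h₂ h₃ δ hcl hper0
  -- `e = 0` from the `θ₁`-period
  have he0 : e = 0 := by
    obtain ⟨K, ρ, cf, hρ, -, hsum⟩ := hδ1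
    have hev := evalCombination_eq_zero_of_isElementaryRelation ρ cf hρ
    rw [← hsum, evalCombination_sub', evalCombination_single, hper1, evalCombination_smul,
      evalCombination_single, period_unit] at hev
    linear_combination -hev
  rw [he0, zero_smul, sub_zero] at hδ1
  refine ⟨?_, ?_⟩
  · obtain ⟨K, ρ, cf, hρ, hcf, hsum⟩ := span_sub hδ0 (hdiff (theta0 L) (hasAlgCoeffs_theta0 L h₂ h₃))
    exact ⟨K, ρ, cf, hρ, hcf, by rw [← hsum]; abel⟩
  · obtain ⟨K, ρ, cf, hρ, hcf, hsum⟩ := span_sub hδ1 (hdiff (theta1 L) (hasAlgCoeffs_theta1 L h₂ h₃))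
    exact ⟨K, ρ, cf, hρ, hcf, by rw [← hsum]; abel⟩

/-- **Lift invariance of the symbol.** For every polynomial `1`-form `ω` over `ℚ̄` and `C¹` lifts
`g, g′ : [0,1] → ℂ ∖ Λ` with the same (algebraic) end points, `(E_L, ω, φ∘g) − (E_L, ω, φ∘g′)` lies
in the `ℚ̄`-span of the elementary relations: the symbol of a path on `E_L` depends only on the
end points OF ITS LIFT to the universal cover (`span_liftPath_sub_liftPath_theta` + the de Rham
reduction `ω ∼ aθ₀ + bθ₁ + dP + ν`, `exists_rel_symbol_uniform`, whose exact part contributes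
`P(φ(g 1)) − P(φ(g 0))` to both). [cite: HuberWustholz2022, §3.3.1 (pp. 42–44), §13.2 (p. 123), §18.1 (p. 160)] -/
theorem span_liftPath_sub_liftPath {g g' : ℝ → ℂ} (hg : ContDiff ℝ 1 g) (hg' : ContDiff ℝ 1 g')
    (hΛ : ∀ t ∈ Icc (0 : ℝ) 1, g t ∉ L.lattice) (hΛ' : ∀ t ∈ Icc (0 : ℝ) 1, g' t ∉ L.lattice)
    (h0 : IsAlgPt L (g 0)) (h1 : IsAlgPt L (g 1)) (h0' : IsAlgPt L (g' 0)) (h1' : IsAlgPt L (g' 1))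
    (hs : g' 0 = g 0) (he : g' 1 = g 1)
    (ω : Fin 2 → MvPolynomial (Fin 2) ℂ) (hω : ∀ k, HasAlgCoeffs (ω k)) :
    InSpan (Finsupp.single (⟨curve L, smooth L h₂ h₃, ω, hω, liftPath L g hg hΛ h0 h1⟩ : PeriodSymbol)
        (1 : ℂ) -
      Finsupp.single (⟨curve L, smooth L h₂ h₃, ω, hω, liftPath L g' hg' hΛ' h0' h1'⟩ : PeriodSymbol) 1) := by
  obtain ⟨hθ0, hθ1⟩ := span_liftPath_sub_liftPath_theta L h₂ h₃ hg hg' hΛ hΛ' h0 h1 h0' h1' hs he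
  obtain ⟨a, b, P, ha, hb, -, hrel⟩ := exists_rel_symbol_uniform L h₂ h₃ ω hω
  have r := hrel (liftPath L g hg hΛ h0 h1)
  have r' := hrel (liftPath L g' hg' hΛ' h0' h1')
  have e1 : (liftPath L g' hg' hΛ' h0' h1').toFun 1 = (liftPath L g hg hΛ h0 h1).toFun 1 := by
    simp [he]
  have e0 : (liftPath L g' hg' hΛ' h0' h1').toFun 0 = (liftPath L g hg hΛ h0 h1).toFun 0 := by
    simp [hs]
  rw [e1, e0] at r'
  obtain ⟨K, ρ, cf, hρ, hcf, hsum⟩ :=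
    span_add (span_add (span_sub r r') (span_smul ha hθ0)) (span_smul hb hθ1)
  refine ⟨K, ρ, cf, hρ, hcf, ?_⟩
  rw [← hsum, smul_sub, smul_sub]
  abel

end LiftInvariance

end Ell

end CurvePeriods

end Literature.NumberTheory.Transcendental

end
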